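import Summits.BirchSwinnertonDyer.BirchSwinnertonDyer.Theses.UniversalToricDescent
import Summits.BirchSwinnertonDyer.BirchSwinnertonDyer.Theorems.UniversalToricDescentRoadFFDescentOddRational
import Summits.BirchSwinnertonDyer.BirchSwinnertonDyer.Theorems.UniversalToricDescentTwinTorsionRankOne
import Summits.BirchSwinnertonDyer.BirchSwinnertonDyer.Theorems.UniversalToricDescentTwinDecLocusCubeTest
import HarnessLib

/-!
# ACT F — LINE-LEVEL PAYOFF (width seat bsd-wall-utd-p2-w2 g3, 2026-08-28): line `membertower_T` for the PROPOSED torsion-conditional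
# twin crux ♭B_T `TwinWanFrameAtThreeMultT` (certificate `Lines/ActF_TorsionConditionalTwin.lean`, commit 90623342ef7c) closes from
# TWO of membertower v4's three research stubs — `stub_memberTowerMult` and `stub_wanFrameMultCube` — with `stub_torsionMult` GONE

This is LEAD g11's registered line membertower v4 (908100b56a68092d on ♭B 26062; = threeframes v7 minus howard/thmB) with ONE change in
the composition: the rational Wan clause is produced UNDER the hypothesis «`X^∅_ac(W′/K_∞; slot 𝔭′)` is `Λ`-torsion» (♭B_T's shape)
instead of from `stub_torsionMult`; the `Σ`-data then come from that hypothesis by w2 g2's `twin_sigmaDataAt_of_isTorsion_empty'`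
(p613967: Shapiro SU14 3.2.3 and the local `Σ`-display are tree theorems) and the clause AT THE SAME FRAME `L` from the LEAD's
rational member-tower kernel (p616714 `P2.RoadFF.map_span_C_pow_mul_fittingIdeal_le_of_rationalMemberTower_odd` + p612782
`AcSelmer.XAc.forall_C_pow_mul_mem_span_of_map_span_mul_fittingIdeal_le`). On the cube locus `stub_wanFrameMultCube` answers
unconditionally. `lean check`: rc 0, sorries = 2 = the two stubs (signatures VERBATIM v7/v4). NOT registered by this seat (no line
exists for a text that is not yet a route decl); it becomes the line of ♭B_T the moment the pen files act F. BSD is not proved by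
any of this; every `sorry` below is a registered research stub of v7/v4.
-/

noncomputable section

open scoped Classical

set_option linter.dupNamespace false
set_option autoImplicit false

namespace Summit.BirchSwinnertonDyer.BirchSwinnertonDyer.Cruxes.TwinWanFrameAtThreeMult.MemberTowerT

open PowerSeries WeierstrassCurve NumberField IsDedekindDomain Field
  Literature.NumberTheory.EllipticCurves
  Literature.NumberTheory.EllipticCurves.ModularForms
  Literature.NumberTheory.EllipticCurves.Rank1Residual
  Literature.NumberTheory.EllipticCurves.BigGaloisRep
  Literature.NumberTheory.EllipticCurves.GreenbergSelmer
  Literature.NumberTheory.GaloisRepresentations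
  Summit.BirchSwinnertonDyer.Rank1Residual.X11b
  Summit.BirchSwinnertonDyer.Rank1Residual.X11b.Halves
  Summit.BirchSwinnertonDyer.BirchSwinnertonDyer.Theorems.SchneiderFree
  Summit.BirchSwinnertonDyer.BirchSwinnertonDyer.Theorems.UniversalToricDescentTwinTorsionRankOne
  Summit.BirchSwinnertonDyer.BirchSwinnertonDyer.Theorems.UniversalToricDescentTwinDecLocus

/-- STUB (= v7/v4 `stub_memberTowerMult` VERBATIM — THE RATIONAL, `m`-UNIFORM HIDA MEMBER TOWER AT THE 3-MULTIPLICATIVE TWIN,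
RESEARCH «beyond print», promote-stub by LEAD g11). [cite: Skinner2016PacificMC, §2.6 (2-6-1), §3.1 (a)(b)(c) (p. 192)]
[cite: Castella2020JIMJ, §2.5, Thm. 2.11] [cite: YanZhu2026, Thm. 4.4, Rem. 4.5, Cor. 4.6 (arXiv:2412.20078 pp. 10–11)] -/
theorem stub_memberTowerMult :
    ∀ (W' : WeierstrassCurve ℚ) [W'.IsElliptic] [W'.IsGloballyMinimal] (N' : ℕ) [NeZero N']
      (K : Type) [Field K] [NumberField K] (Dt' : ModularParametrizationData W' N'),
      Mult W' 3 → W'.HasSurjectiveModNGaloisRep 3 → W'.conductorNorm ℤ = N' → IsImaginaryQuadratic K →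
      SatisfiesHeegnerHypothesis N' K → Odd (NumberField.discr K) →
      ∀ (κ : ZpExtension K 3), κ.IsAnticyclotomic → ∀ (γ : absoluteGaloisGroup K) [Fact (κ.IsTopGenerator γ)]
        (𝔭 : HeightOneSpectrum (𝓞 K)), ((3 : ℕ) : 𝓞 K) ∈ 𝔭.asIdeal →
        𝔭.asIdeal.ramificationIdx (𝓞 ℚ) = 1 → 𝔭.asIdeal.inertiaDeg (𝓞 ℚ) = 1 →
        ∀ (𝔭' : HeightOneSpectrum (𝓞 K)), ((3 : ℕ) : 𝓞 K) ∈ 𝔭'.asIdeal → 𝔭' ≠ 𝔭 →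
        ∀ (ι' : PadicAlgCl 3 ≃+* ℂ), BranchInducesPrime 3 ι' 𝔭 →
        ∃ (ΩK : ℂ) (Ωp : ℂ_[3]) (L : UnrSeries 3),
          ΩK ≠ 0 ∧ Ωp ≠ 0 ∧ IsBDPLFunction ι' 𝔭 κ γ Dt'.f ΩK Ωp L ∧
          ∃ e : ℕ, ∀ m : ℕ, 1 ≤ m →
            ∃ D : Skinner2016.HidaCongruentMember W' 3 m,
              ∀ [TopologicalSpace (PowerSeries (padicCoeffIntegers D.ι))]
                [ContinuousSMul (PowerSeries (padicCoeffIntegers D.ι))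
                  (BigRepModule (padicCoeffIntegers D.ι) 3 (Cofree D.Δ.ρ (padicCoeffField D.ι)))],
              ∀ (S₀ : Type) [CommRing S₀] (a : unrIntegers 3 →+* S₀) (b : padicCoeffIntegers D.ι →+* S₀)
                (j : ℤ_[3] →+* unrIntegers 3),
                (∀ x : ℤ_[3], ((j x : unrIntegers 3) : ℂ_[3]) = algebraMap ℚ_[3] ℂ_[3] (x : ℚ_[3])) →
                a.comp j = b.comp (algebraMap ℤ_[3] (padicCoeffIntegers D.ι)) →
                ∃ Lm : PowerSeries S₀,
                  (Module.IsTorsion (PowerSeries (padicCoeffIntegers D.ι))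
                      (XBig κ (D.Δ.cofreeRepOver K) 𝔭' (↑(W'.sigmaPlacesFinset 3 K))) →
                    Ideal.span {((3 : ℕ) : PowerSeries S₀) ^ e} *
                        (XBig.charIdeal κ (D.Δ.cofreeRepOver K) 𝔭' (↑(W'.sigmaPlacesFinset 3 K))).map
                          (PowerSeries.map b) ≤ Ideal.span {Lm}) ∧
                  Ideal.span {Lm} ≤
                    Ideal.span {PowerSeries.map a (L * PowerSeries.map j (W'.sigmaEulerElement 3 K κ))} ⊔
                      Ideal.span {((3 : ℕ) : PowerSeries S₀) ^ m} := by
  sorry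

/-- STUB (= v7/v4 `stub_wanFrameMultCube` VERBATIM — THE CUBE LOCUS, research).
[cite: SilvermanATAEC1994, Thm. V.3.1 (d) and Thm. V.5.3 (the locus)] [cite: Castella2018Erratum, Thm. A′ (2) and Remark (p. 2)] -/
theorem stub_wanFrameMultCube :
    ∀ (W' : WeierstrassCurve ℚ) [W'.IsElliptic] [W'.IsGloballyMinimal] (N' : ℕ) [NeZero N']
      (K : Type) [Field K] [NumberField K] (Dt' : ModularParametrizationData W' N'),
      Mult W' 3 → W'.HasSurjectiveModNGaloisRep 3 → W'.conductorNorm ℤ = N' → IsImaginaryQuadratic K →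
      SatisfiesHeegnerHypothesis N' K → Odd (NumberField.discr K) →
      ∀ (κ : ZpExtension K 3), κ.IsAnticyclotomic → ∀ (γ : absoluteGaloisGroup K) [Fact (κ.IsTopGenerator γ)]
        (𝔭 : HeightOneSpectrum (𝓞 K)), ((3 : ℕ) : 𝓞 K) ∈ 𝔭.asIdeal →
        𝔭.asIdeal.ramificationIdx (𝓞 ℚ) = 1 → 𝔭.asIdeal.inertiaDeg (𝓞 ℚ) = 1 →
        ∀ (𝔭' : HeightOneSpectrum (𝓞 K)), ((3 : ℕ) : 𝓞 K) ∈ 𝔭'.asIdeal → 𝔭' ≠ 𝔭 →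
        ∀ (ι' : PadicAlgCl 3 ≃+* ℂ), BranchInducesPrime 3 ι' 𝔭 →
        ∀ (D : WeierstrassCurve.TateParameterData W' 3) (u : ℚ_[3]), u ^ 3 = D.q →
        ∃ (ΩK : ℂ) (Ωp : ℂ_[3]) (L : UnrSeries 3), ΩK ≠ 0 ∧ Ωp ≠ 0 ∧
          IsBDPLFunction ι' 𝔭 κ γ Dt'.f ΩK Ωp L ∧
          ∃ k : ℕ, ∀ G ∈ (AcSelmer.XAc.charIdeal (W'.baseChange K) 3 κ 𝔭' ∅ γ).map
            (PowerSeries.map (toUnr 3)), PowerSeries.C (((3 : ℕ) : unrIntegers 3) ^ k) * G ∈ Ideal.span {L} := by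
  sorry

/-- DERIVED (no sorry of its own): on the (dec) locus `W′(ℚ₃)[3] = 0`, the rational Wan clause AT A GIVEN FRAME `L` carrying a
rational `m`-uniform member tower, UNDER torsion of `X^∅_ac(W′/K_∞; slot 𝔭′)` — `Σ`-data from torsion
(`twin_sigmaDataAt_of_isTorsion_empty'`, p613967), Fitting-level descent (p616714), recombination (p612782); the two lines of
p616714's `twin_exists_wanFrame_of_sigmaData_of_rationalMemberTower`, kept at the same `L`.
[cite: Skinner2016PacificMC, §3.1 (p. 192) (mechanism)] [cite: JetchevSkinnerWan2017, §5.1] -/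
theorem wanClause_of_rationalMemberTower_of_isTorsion
    (W' : WeierstrassCurve ℚ) [W'.IsElliptic] [W'.IsGloballyMinimal] (N' : ℕ)
    (K : Type) [Field K] [NumberField K]
    (hm : Mult W' 3) (hsurj : W'.HasSurjectiveModNGaloisRep 3) (hN : W'.conductorNorm ℤ = N')
    (hK : IsImaginaryQuadratic K) (hH : SatisfiesHeegnerHypothesis N' K)
    (κ : ZpExtension K 3) (hκ : κ.IsAnticyclotomic) (γ : Field.absoluteGaloisGroup K) [Fact (κ.IsTopGenerator γ)]
    (𝔭' : HeightOneSpectrum (𝓞 K)) (h𝔭' : ((3 : ℕ) : 𝓞 K) ∈ 𝔭'.asIdeal)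
    (hiv : ∀ Q : (W'.baseChange ℚ_[3]).toAffine.Point, 3 • Q = 0 → Q = 0)
    (hT₀ : Module.IsTorsion (IwasawaAlgebra 3) (AcSelmer.XAc (W'.baseChange K) 3 κ 𝔭' ∅ γ))
    (L : UnrSeries 3) (e : ℕ)
    (hmem : ∀ m : ℕ, 1 ≤ m →
      ∃ D : Skinner2016.HidaCongruentMember W' 3 m,
        ∀ [TopologicalSpace (PowerSeries (padicCoeffIntegers D.ι))]
          [ContinuousSMul (PowerSeries (padicCoeffIntegers D.ι))
            (BigRepModule (padicCoeffIntegers D.ι) 3 (Cofree D.Δ.ρ (padicCoeffField D.ι)))],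
        ∀ (S₀ : Type) [CommRing S₀] (a : unrIntegers 3 →+* S₀) (b : padicCoeffIntegers D.ι →+* S₀)
          (j : ℤ_[3] →+* unrIntegers 3),
          (∀ x : ℤ_[3], ((j x : unrIntegers 3) : ℂ_[3]) = algebraMap ℚ_[3] ℂ_[3] (x : ℚ_[3])) →
          a.comp j = b.comp (algebraMap ℤ_[3] (padicCoeffIntegers D.ι)) →
          ∃ Lm : PowerSeries S₀,
            (Module.IsTorsion (PowerSeries (padicCoeffIntegers D.ι))
                (XBig κ (D.Δ.cofreeRepOver K) 𝔭' (↑(W'.sigmaPlacesFinset 3 K))) →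
              Ideal.span {((3 : ℕ) : PowerSeries S₀) ^ e} *
                  (XBig.charIdeal κ (D.Δ.cofreeRepOver K) 𝔭' (↑(W'.sigmaPlacesFinset 3 K))).map
                    (PowerSeries.map b) ≤ Ideal.span {Lm}) ∧
            Ideal.span {Lm} ≤
              Ideal.span {PowerSeries.map a (L * PowerSeries.map j (W'.sigmaEulerElement 3 K κ))} ⊔
                Ideal.span {((3 : ℕ) : PowerSeries S₀) ^ m}) :
    ∀ G ∈ (AcSelmer.XAc.charIdeal (W'.baseChange K) 3 κ 𝔭' ∅ γ).map (PowerSeries.map (toUnr 3)),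
      PowerSeries.C (((3 : ℕ) : unrIntegers 3) ^ e) * G ∈ Ideal.span {L} := by
  have hirr : Irr W' 3 := hasIrreducibleModPGaloisRep_of_hasSurjectiveModNGaloisRep W' 3 hsurj
  have hsp : SplitsIn K 3 := hH 3 Nat.prime_three (hN ▸ dvd_conductorNorm_of_mult hm)
  have key := P2.RoadFF.map_span_C_pow_mul_fittingIdeal_le_of_rationalMemberTower_odd
    SkinnerUrban2014.prop323_XAc_equiv_XBigDecomp_holds W' 3 le_rfl K hK hirr hm hsp hiv κ hκ γ 𝔭' h𝔭' L e hmem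
  obtain ⟨hSfin, hT, hPS, hX⟩ := twin_sigmaDataAt_of_isTorsion_empty' W' N' K hm hN hK hH κ hκ γ 𝔭' h𝔭' hT₀
  exact AcSelmer.XAc.forall_C_pow_mul_mem_span_of_map_span_mul_fittingIdeal_le (W'.baseChange K) 3 κ 𝔭' γ hSfin hT e
    key hPS hX (dvd_refl _)

/-- **♭B_T FROM THE TWO STUBS** (`stub_torsionMult` is not used): the PROPOSED torsion-conditional twin crux
`TwinWanFrameAtThreeMultT` (act F certificate `Lines/ActF_TorsionConditionalTwin.lean`; text spelled out here) by the exact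
dichotomy `twin_dec_or_cube` (p612881): on the (dec) locus the frame is the member tower's and the clause — owed only under torsion —
is `wanClause_of_rationalMemberTower_of_isTorsion`; on the cube locus `stub_wanFrameMultCube` gives frame and clause outright.
[cite: Skinner2016PacificMC, §3.1 (p. 192) (mechanism)] [cite: SilvermanATAEC1994, Thm. V.3.1 (d) and Thm. V.5.3 (the dichotomy)] -/
theorem twinWanFrameAtThreeMultT_of :
    ∀ (W' : WeierstrassCurve ℚ) [W'.IsElliptic] [W'.IsGloballyMinimal] (N' : ℕ) [NeZero N'] (K : Type) [Field K]
      [NumberField K] (Dt' : ModularParametrizationData W' N'),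
      Mult W' 3 → W'.HasSurjectiveModNGaloisRep 3 → W'.conductorNorm ℤ = N' → IsImaginaryQuadratic K →
      SatisfiesHeegnerHypothesis N' K → Odd (NumberField.discr K) →
      ∀ (κ : ZpExtension K 3), κ.IsAnticyclotomic → ∀ (γ : absoluteGaloisGroup K) [Fact (κ.IsTopGenerator γ)]
        (𝔭 : HeightOneSpectrum (𝓞 K)), ((3 : ℕ) : 𝓞 K) ∈ 𝔭.asIdeal →
        𝔭.asIdeal.ramificationIdx (𝓞 ℚ) = 1 → 𝔭.asIdeal.inertiaDeg (𝓞 ℚ) = 1 →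
        ∀ (𝔭' : HeightOneSpectrum (𝓞 K)), ((3 : ℕ) : 𝓞 K) ∈ 𝔭'.asIdeal → 𝔭' ≠ 𝔭 →
        ∀ (ι' : PadicAlgCl 3 ≃+* ℂ), BranchInducesPrime 3 ι' 𝔭 →
        ∃ (ΩK : ℂ) (Ωp : ℂ_[3]) (L : UnrSeries 3), ΩK ≠ 0 ∧ Ωp ≠ 0 ∧ IsBDPLFunction ι' 𝔭 κ γ Dt'.f ΩK Ωp L ∧
          (Module.IsTorsion (IwasawaAlgebra 3) (AcSelmer.XAc (W'.baseChange K) 3 κ 𝔭' ∅ γ) →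
            ∃ k : ℕ, ∀ G ∈ (AcSelmer.XAc.charIdeal (W'.baseChange K) 3 κ 𝔭' ∅ γ).map (PowerSeries.map (toUnr 3)),
              PowerSeries.C (((3 : ℕ) : unrIntegers 3) ^ k) * G ∈ Ideal.span {L}) := by
  intro W' _ _ N' _ K _ _ Dt' hmult hsurj hN' hK hH hodd κ hκ γ _ 𝔭 h𝔭 he hf 𝔭' h𝔭' hne ι' hι'
  rcases twin_dec_or_cube W' hmult with hdec | ⟨D, u, hu⟩
  · obtain ⟨ΩK, Ωp, L, hΩ, hΩp, hL, e, hmem⟩ :=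
      stub_memberTowerMult W' N' K Dt' hmult hsurj hN' hK hH hodd κ hκ γ 𝔭 h𝔭 he hf 𝔭' h𝔭' hne ι' hι'
    exact ⟨ΩK, Ωp, L, hΩ, hΩp, hL, fun hT₀ ↦ ⟨e, wanClause_of_rationalMemberTower_of_isTorsion W' N' K hmult hsurj hN' hK
      hH κ hκ γ 𝔭' h𝔭' hdec hT₀ L e hmem⟩⟩
  · obtain ⟨ΩK, Ωp, L, hΩ, hΩp, hL, hk⟩ :=
      stub_wanFrameMultCube W' N' K Dt' hmult hsurj hN' hK hH hodd κ hκ γ 𝔭 h𝔭 he hf 𝔭' h𝔭' hne ι' hι' D u hu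
    exact ⟨ΩK, Ωp, L, hΩ, hΩp, hL, fun _ ↦ hk⟩

end Summit.BirchSwinnertonDyer.BirchSwinnertonDyer.Cruxes.TwinWanFrameAtThreeMult.MemberTowerT

end
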